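import Mathlib
import Summits.Ventures.PercRepro.TriangleCapBelowMixed

/-!
# PercRepro — THE STABILITY TABLE ONE AND TWO BELOW THE DIAGONAL FOR EVERY ROW: on the cell `(k, a, r)` with
`r ≤ 2`, `r + 3 ≤ a` (so `a ≥ 4` at `r = 1`, `a ≥ 5` at `r = 2`) and `2a + r ≤ k`, every `K₄⁻`-free graph that is
not `a`-bipartite is at least `B2 = 2 (k − 2a − 1)(a − r)` below the closed form; at `r = 1` the second-best value
of the cherry table is therefore EXACTLY `m k − (k − 2) − 2 (k − 2a − 1)(a − 1)` for every `a ≥ 4` (p3, gen 44;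
part 196c)

The induction on `k` of part 195b with the pieces of parts 196a/b, `r ≤ 2` carried inside: `k ≤ 2a + 1` is the
closed form (the target is `0` there); a vertex at the cap `k − a` makes `D` `a`-bipartite (`below_cap_gen`,
`r ≤ a − 3`); every degree in `[a + 1, k − a − 1]` gives `k (k − 2a − 1)` (`below_convex_gen`); a vertex `z` of
degree `d` with `r + d ≤ a − 1` is the cross-row deletion (`below_cross_gen`); a vertex `z` of degree `d` with
`r + d ≥ a` is deleted onto the cell `(k − 1, a, r')`, `r' = r + d − a ≤ r`, in the dense corner of `k − 1` — where
the induction hypothesis applies: `D − z` `a`-bipartite ⇒ the neighbours of `z` lie on one side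
(`nbhd_one_side_of_bipSub`, `r' + 3 ≤ d`): the small side makes `D` `a`-bipartite, the large side makes `D`
`(a + 1)`-bipartite with `k − 2a − 1 + r` missing pairs, whose bipartite bound IS the target (`below_bip_arith`);
or the gap `2 (k − 2a − 2)(a − r')` at `k − 1` and the neighbours at `≤ k − a − 2` close the count
(`below_within_arith_gap`) — or at the corner `k = 2a + 2`, `r = 2`, `d = a`, where `D − z` lies on the
diagonal of the row `a − 1` (part 195b, `diag_second_order_all`): exact (`below_corner_arith`).
`one_below_second_best_gen (k a) (4 ≤ a) (2a + 2 ≤ k)`: the second-best value on the cell `(k, a, 1)`, attained by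
`K_{a+1,k−a−1}` minus a `(k − 2a)`-star (`other_bipartition_value`). Axioms: standard.
-/

namespace PercRepro

namespace TriangleCap

namespace C047

open Finset

universe u

variable {V : Type*} [Fintype V] [DecidableEq V]

/-- The edge count of the other bipartition: `m + r = a (k − a)`, `2a + 2 ≤ k` ⇒
`m + (k − 2a − 1 + r) = (a + 1)(k − (a + 1))`. -/
theorem below_bip_edges (a r k m : ℕ) (hk : 2 * a + 2 ≤ k) (hm : m + r = a * (k - a)) :
    m + (k - 2 * a - 1 + r) = (a + 1) * (k - (a + 1)) := by
  obtain ⟨c, rfl⟩ : ∃ c, k = 2 * a + 2 + c := ⟨k - (2 * a + 2), by omega⟩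
  have e1 : 2 * a + 2 + c - a = a + 2 + c := by omega
  have e2 : 2 * a + 2 + c - 2 * a - 1 = c + 1 := by omega
  have e3 : 2 * a + 2 + c - (a + 1) = a + 1 + c := by omega
  rw [e1] at hm
  rw [e2, e3]
  nlinarith [hm]

/-- The within-row case with `D` `(a + 1)`-bipartite: the bipartite bound with `k − 2a − 1 + r` missing pairs
gives the target (`r ≤ a`, `2a + 2 ≤ k`). -/
theorem below_bip_assemble (a r k S m : ℕ) (hr : r ≤ a) (hk : 2 * a + 2 ≤ k)
    (hbip : S + (k - 2 * a - 1 + r) * (k - 1 - (k - 2 * a - 1 + r)) ≤ m * k) :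
    S + r * (k - 1 - r) + 2 * (k - 2 * a - 1) * (a - r) ≤ m * k := by
  obtain ⟨q, rfl⟩ : ∃ q, a = r + q := ⟨a - r, by omega⟩
  obtain ⟨c, rfl⟩ : ∃ c, k = 2 * (r + q) + 2 + c := ⟨k - (2 * (r + q) + 2), by omega⟩
  have e1 : 2 * (r + q) + 2 + c - 2 * (r + q) - 1 + r = c + 1 + r := by omega
  have e2 : 2 * (r + q) + 2 + c - 1 - (c + 1 + r) = r + 2 * q := by omega
  have e3 : 2 * (r + q) + 2 + c - 1 - r = r + 2 * q + 1 + c := by omega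
  have e4 : 2 * (r + q) + 2 + c - 2 * (r + q) - 1 = c + 1 := by omega
  have e5 : r + q - r = q := by omega
  rw [e1, e2] at hbip
  rw [e3, e4, e5]
  have := below_bip_arith r q c
  linarith

/-- The within-row case with the induction hypothesis at `(k − 1, a, r')`: the assembly of
`below_within_arith_gap` (`r + d = a + r'`, `r' ≤ r`, `2a + 2 ≤ k`). -/
theorem below_within_assemble (a r r' d k m' S' T : ℕ) (hk : 2 * a + 2 ≤ k) (hra : r ≤ a)
    (hrd : r + d = a + r') (hr'r : r' ≤ r) (hmd : m' + d + r = a * (k - a))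
    (hgap : S' + r' * (k - 1 - 1 - r') + 2 * (k - 1 - 2 * a - 1) * (a - r') ≤ m' * (k - 1))
    (hT : T ≤ d * (k - a - 2)) :
    S' + 2 * T + d + d * d + r * (k - 1 - r) + 2 * (k - 2 * a - 1) * (a - r) ≤ (m' + d) * k := by
  obtain ⟨s, rfl⟩ : ∃ s, r = r' + s := ⟨r - r', by omega⟩
  obtain ⟨q, hq⟩ : ∃ q, a = r' + s + q := ⟨a - (r' + s), by omega⟩
  obtain rfl : d = q + r' := by omega
  subst hq
  obtain ⟨c, rfl⟩ : ∃ c, k = 2 * (r' + s + q) + 2 + c := ⟨k - (2 * (r' + s + q) + 2), by omega⟩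
  have e1 : 2 * (r' + s + q) + 2 + c - (r' + s + q) = r' + s + q + 2 + c := by omega
  have e2 : 2 * (r' + s + q) + 2 + c - 1 - 1 - r' = r' + 2 * s + 2 * q + c := by omega
  have e3 : 2 * (r' + s + q) + 2 + c - 1 - 2 * (r' + s + q) - 1 = c := by omega
  have e4 : r' + s + q - r' = s + q := by omega
  have e5 : 2 * (r' + s + q) + 2 + c - 1 = 2 * (r' + s + q) + 1 + c := by omega
  have e6 : 2 * (r' + s + q) + 2 + c - (r' + s + q) - 2 = r' + s + q + c := by omega
  have e7 : 2 * (r' + s + q) + 2 + c - 1 - (r' + s) = r' + s + 2 * q + 1 + c := by omega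
  have e8 : 2 * (r' + s + q) + 2 + c - 2 * (r' + s + q) - 1 = c + 1 := by omega
  have e9 : r' + s + q - (r' + s) = q := by omega
  rw [e1] at hmd
  rw [e2, e3, e4, e5] at hgap
  rw [e6] at hT
  rw [e7, e8, e9]
  exact below_within_arith_gap r' s q c m' S' T hmd hgap hT

/-- The corner assembly: `r = 2`, `k = 2a + 2`, `d = a`, `a ≥ 5`, `D − z` on the diagonal of the row `a − 1`. -/
theorem below_corner_assemble (a m' S' T : ℕ) (ha : 5 ≤ a) (hmd : m' + a + 2 = a * (2 * a + 2 - a))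
    (hgap : S' + 2 * (a - 1) * (2 * a + 2 - 1 - 2 * (a - 1) - 1) ≤ m' * (2 * a + 2 - 1))
    (hT : T ≤ a * (2 * a + 2 - a - 2)) :
    S' + 2 * T + a + a * a + 2 * (2 * a + 2 - 1 - 2) + 2 * (2 * a + 2 - 2 * a - 1) * (a - 2) ≤
      (m' + a) * (2 * a + 2) := by
  obtain ⟨a5, rfl⟩ : ∃ a5, a = a5 + 5 := ⟨a - 5, by omega⟩
  have e1 : 2 * (a5 + 5) + 2 - (a5 + 5) = a5 + 5 + 2 := by omega
  have e2 : a5 + 5 - 1 = a5 + 4 := by omega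
  have e3 : 2 * (a5 + 5) + 2 - 1 - 2 * (a5 + 4) - 1 = 2 := by omega
  have e4 : 2 * (a5 + 5) + 2 - 1 = 2 * (a5 + 5) + 1 := by omega
  have e5 : 2 * (a5 + 5) + 2 - (a5 + 5) - 2 = a5 + 5 := by omega
  rw [e1] at hmd
  rw [e2, e3, e4] at hgap
  rw [e5] at hT
  exact below_corner_arith a5 m' S' T hmd hgap hT

/-- The edge count of `D − z` on the cell `(k − 1, a, r')`: `m' + d = m`, `m + r = a (k − a)`, `r + d = a + r'`. -/
theorem below_cell_edges (a r r' d k m m' : ℕ) (hk : 2 * a + 2 ≤ k) (hrd : r + d = a + r') (hed : m' + d = m)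
    (hm : m + r = a * (k - a)) : m' + r' = a * (k - 1 - a) := by
  have hmk : a * (k - a) = a * (k - 1 - a) + a := by
    rw [← Nat.mul_succ]
    congr 1
    omega
  omega

/-- The edge count at the corner: `m' + a + 2 = a (a + 2)` ⇒ `m' = (a − 1)(a + 2)`, the diagonal of the row
`a − 1` on `2a + 1` vertices. -/
theorem below_corner_edges (a m' : ℕ) (ha : 5 ≤ a) (hmd : m' + a + 2 = a * (2 * a + 2 - a)) :
    m' = (a - 1) * (2 * a + 2 - 1 - (a - 1)) := by
  obtain ⟨a5, rfl⟩ : ∃ a5, a = a5 + 5 := ⟨a - 5, by omega⟩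
  have e1 : 2 * (a5 + 5) + 2 - (a5 + 5) = a5 + 7 := by omega
  have e2 : 2 * (a5 + 5) + 2 - 1 - (a5 + 5 - 1) = a5 + 7 := by omega
  have e3 : a5 + 5 - 1 = a5 + 4 := by omega
  rw [e1] at hmd
  rw [e2, e3]
  nlinarith [hmd]

/-- **THE CORNER `k = 2a + 2`, `r = 2`, A VERTEX `z` OF DEGREE `a`:** `D − z` lies on the diagonal of the row
`a − 1` (part 195b): it is `K_{a−1,a+2}` with the neighbours of `z` off the small side (`D` is `a`-bipartite), or
it is `2 (a − 1) · 2` below, which the neighbours of `z` at `≤ a` close exactly. -/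
theorem below_corner_case (D : SimpleGraph V) [DecidableRel D.Adj] (hK : K4mFree D) (a : ℕ) (ha5 : 5 ≤ a)
    (hk : Fintype.card V = 2 * a + 2) (hm : D.edgeFinset.card + 2 = a * (Fintype.card V - a))
    (hcap' : ∀ v, deg D v + a + 1 ≤ Fintype.card V) (z : V) (hz : deg D z = a) :
    (∃ A : Finset V, A.card = a ∧ BipSub D A) ∨
      ∑ v, deg D v * deg D v + 2 * (Fintype.card V - 1 - 2) + 2 * (Fintype.card V - 2 * a - 1) * (a - 2) ≤
        D.edgeFinset.card * Fintype.card V := by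
  have hK' := k4mFree_del D hK z
  have hcard' := card_del z
  have hedges' := card_edges_del D z
  have hsq := sum_deg_sq_del D z
  have hT := sum_del_nbhd_le D z (Fintype.card V - a - 2) (fun v => by have := hcap' v; omega)
  have hnb : (univ.filter (fun w : {v : V // v ≠ z} => D.Adj w.1 z)).card = a := by
    have h := sum_del_nbhd_const D z 1
    rw [hz, mul_one, ← card_filter] at h
    exact h
  rw [hz] at hedges' hsq hT
  obtain ⟨T, hTdef⟩ : ∃ T, ∑ w : {v : V // v ≠ z}, (if D.Adj w.1 z then deg (del D z) w else 0) = T := ⟨_, rfl⟩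
  obtain ⟨S', hS'def⟩ : ∃ S', ∑ w : {v : V // v ≠ z}, deg (del D z) w * deg (del D z) w = S' := ⟨_, rfl⟩
  obtain ⟨m', hm'def⟩ : ∃ m', (del D z).edgeFinset.card = m' := ⟨_, rfl⟩
  rw [hTdef, hS'def] at hsq
  rw [hTdef, hk] at hT
  rw [hm'def] at hedges'
  have hcardW' : Fintype.card {v : V // v ≠ z} = 2 * a + 2 - 1 := by omega
  rw [hk] at hm ⊢
  have hmd : m' + a + 2 = a * (2 * a + 2 - a) := by omega
  have hm'' : (del D z).edgeFinset.card = (a - 1) * (Fintype.card {v : V // v ≠ z} - (a - 1)) := by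
    rw [hm'def, hcardW']
    exact below_corner_edges a m' ha5 hmd
  clear hTdef hm
  rcases diag_second_order_all (del D z) hK' (a - 1) (by omega) (by omega) hm'' with ⟨A', hA'card, hA'⟩ | hgap
  · -- `D − z = K_{a−1,a+2}`: the `a` neighbours of `z` lie off `A'` (not all in `A'`: `|A'| = a − 1`)
    rcases nbhd_one_side_of_bipSub D hK z A' (a - 1) 0 hA'card hA' (by rw [add_zero]; exact hm'')
      (by omega) with hin | hoff
    · exfalso
      have hsub : univ.filter (fun w : {v : V // v ≠ z} => D.Adj w.1 z) ⊆ A' := by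
        intro w hw
        rw [mem_filter] at hw
        exact hin w hw.2
      have := card_le_card hsub
      omega
    · obtain ⟨A, hAcard, hA⟩ := bipSub_insert_of_nbhd_off D z A' hA' hoff
      exact Or.inl ⟨A, by rw [hAcard, hA'card]; omega, hA⟩
  · right
    rw [hS'def, hm'def, hcardW'] at hgap
    rw [hsq, ← hedges']
    clear hS'def hm'def hsq hedges' hm'' hnb hcardW' hcard' hcap' hk
    exact below_corner_assemble a m' S' T ha5 hmd hgap hT

/-- **THE WITHIN-ROW CASE:** a vertex `z` of degree `d ≤ a` with `r + d = a + r'` on the cell `(k, a, r)`,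
`r + 3 ≤ a`, `2a + 2 ≤ k`, every degree `≤ k − a − 1`, given the statement for `D − z` on the cell `(k − 1, a, r')`
(the induction hypothesis): `D` is `a`-bipartite or at least `2 (k − 2a − 1)(a − r)` below the closed form. -/
theorem below_within_case (D : SimpleGraph V) [DecidableRel D.Adj] (hK : K4mFree D) (a r : ℕ) (har : r + 3 ≤ a)
    (hk2 : 2 * a + 2 ≤ Fintype.card V) (hm : D.edgeFinset.card + r = a * (Fintype.card V - a))
    (hcap' : ∀ v, deg D v + a + 1 ≤ Fintype.card V) (z : V) (hz : deg D z ≤ a) (r' : ℕ)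
    (hr' : r + deg D z = a + r')
    (hIH : (∃ A' : Finset {v : V // v ≠ z}, A'.card = a ∧ BipSub (del D z) A') ∨
      ∑ w : {v : V // v ≠ z}, deg (del D z) w * deg (del D z) w + r' * (Fintype.card {v : V // v ≠ z} - 1 - r') +
        2 * (Fintype.card {v : V // v ≠ z} - 2 * a - 1) * (a - r') ≤
        (del D z).edgeFinset.card * Fintype.card {v : V // v ≠ z}) :
    (∃ A : Finset V, A.card = a ∧ BipSub D A) ∨
      ∑ v, deg D v * deg D v + r * (Fintype.card V - 1 - r) + 2 * (Fintype.card V - 2 * a - 1) * (a - r) ≤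
        D.edgeFinset.card * Fintype.card V := by
  have hcard' := card_del z
  have hedges' := card_edges_del D z
  obtain ⟨k, hk'⟩ : ∃ k, Fintype.card V = k := ⟨_, rfl⟩
  have hcardW' : Fintype.card {v : V // v ≠ z} = k - 1 := by omega
  obtain ⟨d, hd⟩ : ∃ d, deg D z = d := ⟨_, rfl⟩
  rw [hd] at hz hr' hedges'
  obtain ⟨m', hm'def⟩ : ∃ m', (del D z).edgeFinset.card = m' := ⟨_, rfl⟩
  rw [hm'def] at hedges'
  rw [hk'] at hk2 hm
  have hm' : (del D z).edgeFinset.card + r' = a * (Fintype.card {v : V // v ≠ z} - a) := by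
    rw [hm'def, hcardW']
    exact below_cell_edges a r r' d k D.edgeFinset.card m' hk2 hr' hedges' hm
  rcases hIH with ⟨A', hA'card, hA'⟩ | hgap
  · -- `D − z` is `a`-bipartite with `r'` missing pairs: the neighbours of `z` lie on one side
    rcases nbhd_one_side_of_bipSub D hK z A' a r' hA'card hA' hm' (by omega) with hin | hoff
    · obtain ⟨B, hBcard, hB⟩ := bipSub_lift D z A' hA' hin
      exact Or.inl ⟨B, by rw [hBcard, hA'card], hB⟩
    · -- the large side: `D` is `(a + 1)`-bipartite with `k − 2a − 1 + r` missing pairs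
      right
      obtain ⟨A, hAcard, hA⟩ := bipSub_insert_of_nbhd_off D z A' hA' hoff
      have hbip := sum_deg_sq_le_of_bipSub D A hA (a + 1) (Fintype.card V - 2 * a - 1 + r)
        (by rw [hAcard, hA'card]) (by rw [hk']; exact below_bip_edges a r k D.edgeFinset.card hk2 hm)
        (by rw [hk']; omega)
      rw [hk'] at hbip ⊢
      exact below_bip_assemble a r k _ _ (by omega) hk2 hbip
  · -- the gap at `k − 1`: the neighbours of `z` at `≤ k − a − 2` close the count
    right
    have hsq := sum_deg_sq_del D z
    have hT := sum_del_nbhd_le D z (Fintype.card V - a - 2) (fun v => by have := hcap' v; omega)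
    rw [hd] at hsq hT
    obtain ⟨T, hTdef⟩ : ∃ T, ∑ w : {v : V // v ≠ z}, (if D.Adj w.1 z then deg (del D z) w else 0) = T := ⟨_, rfl⟩
    obtain ⟨S', hS'def⟩ : ∃ S', ∑ w : {v : V // v ≠ z}, deg (del D z) w * deg (del D z) w = S' := ⟨_, rfl⟩
    rw [hTdef, hS'def] at hsq
    rw [hTdef, hk'] at hT
    rw [hS'def, hm'def, hcardW'] at hgap
    rw [hsq, ← hedges', hk']
    clear hTdef hS'def hsq hm'def hm' hcardW' hcard' hcap' hd hk'
    exact below_within_assemble a r r' d k m' S' T hk2 (by omega) hr' (by omega)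
      (by rw [hedges']; exact hm) hgap hT

/-- **THE STABILITY TABLE BELOW THE DIAGONAL, `r ≤ 2`, EVERY VERTEX TYPE, BY INDUCTION ON `k`:** `K₄⁻`-free,
`4 ≤ a`, `r ≤ 2`, `r + 3 ≤ a`, `2a + r ≤ k`, `m + r = a (k − a)` ⇒ `a`-bipartite or
`Σ_v d(v)² + r (k − 1 − r) + 2 (k − 2a − 1)(a − r) ≤ m k`. -/
theorem below_second_order_gen_aux (n : ℕ) :
    ∀ (W : Type u) [Fintype W] [DecidableEq W] (D : SimpleGraph W) [DecidableRel D.Adj], Fintype.card W = n →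
      K4mFree D → ∀ a r : ℕ, 4 ≤ a → r ≤ 2 → r + 3 ≤ a → 2 * a + r ≤ Fintype.card W →
      D.edgeFinset.card + r = a * (Fintype.card W - a) →
      (∃ A : Finset W, A.card = a ∧ BipSub D A) ∨
        ∑ v, deg D v * deg D v + r * (Fintype.card W - 1 - r) + 2 * (Fintype.card W - 2 * a - 1) * (a - r) ≤
          D.edgeFinset.card * Fintype.card W := by
  refine Nat.strong_induction_on n ?_
  intro n ih W _ _ D _ hn hK a r ha4 hr2 har hk hm
  -- `k ≤ 2a + 1`: the closed form
  rcases Nat.lt_or_ge (Fintype.card W) (2 * a + 2) with hk1 | hk2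
  · right
    have h := closed_form_stability D hK a r (by omega) hk
      (below_cap_arith a (Fintype.card W) D.edgeFinset.card r (by omega) hm)
    have e : Fintype.card W - 2 * a - 1 = 0 := by omega
    rw [e, mul_zero, zero_mul, add_zero]
    exact h
  -- (A) a vertex at the cap `k − a` makes `D` `a`-bipartite
  by_cases hx : ∃ x, deg D x + a = Fintype.card W
  · obtain ⟨x, hx⟩ := hx
    exact Or.inl (below_cap_gen D hK a r ha4 har hk hm (by omega) (fun _ => by omega) x hx)
  push Not at hx
  have hcap : ∀ v, deg D v + a ≤ Fintype.card W := fun v =>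
    deg_add_le_card_of_dense D hK a (by omega) (by omega)
      (cap_arith a (Fintype.card W) D.edgeFinset.card r (by omega) hk
        (below_cap_arith a (Fintype.card W) D.edgeFinset.card r (by omega) hm)) v
  have hcap' : ∀ v, deg D v + a + 1 ≤ Fintype.card W := fun v => by
    have h1 := hcap v
    have h2 := hx v
    omega
  -- (B) every degree `≥ a + 1`: the convexity of the row `a + 1`
  by_cases hdeg : ∀ v, a + 1 ≤ deg D v
  · right
    have h := below_convex_gen D a r (by omega) (by omega) hm hcap' hdeg
    have h2 : 2 * (Fintype.card W - 2 * a - 1) * (a - r) ≤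
        Fintype.card W * (Fintype.card W - 2 * a - 1) := by
      rw [mul_right_comm]
      exact Nat.mul_le_mul_right _ (by omega)
    omega
  push Not at hdeg
  obtain ⟨z, hz⟩ := hdeg
  -- (C) `r + d ≤ a − 1`: the cross-row deletion
  rcases Nat.lt_or_ge (r + deg D z) a with hz1 | hz2
  · exact Or.inr (below_cross_gen D hK a r (by omega) hk2 hm hcap' z (by omega))
  -- (D) `r + d ≥ a`: the within-row deletion onto the cell `(k − 1, a, r')`, `r' = r + d − a`
  obtain ⟨r', hr'⟩ : ∃ r', r + deg D z = a + r' := ⟨r + deg D z - a, by omega⟩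
  have hcard' := card_del z
  rcases Nat.lt_or_ge (Fintype.card W - 1) (2 * a + r') with hcorner | hcell
  · -- THE CORNER: `k = 2a + 2`, `r = 2`, `d = a`
    have hk22 : Fintype.card W = 2 * a + 2 := by omega
    have hr22 : r = 2 := by omega
    have hza : deg D z = a := by omega
    subst hr22
    exact below_corner_case D hK a (by omega) hk22 hm hcap' z hza
  · -- THE DENSE CORNER OF `k − 1`: the induction hypothesis at `(k − 1, a, r')`
    have hedges' := card_edges_del D z
    have hm' : (del D z).edgeFinset.card + r' = a * (Fintype.card {v : W // v ≠ z} - a) := by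
      have e : Fintype.card {v : W // v ≠ z} = Fintype.card W - 1 := by omega
      rw [e]
      exact below_cell_edges a r r' (deg D z) (Fintype.card W) D.edgeFinset.card (del D z).edgeFinset.card
        hk2 hr' hedges' hm
    have hIH := ih (Fintype.card {v : W // v ≠ z}) (by omega) {v : W // v ≠ z} (del D z) rfl
      (k4mFree_del D hK z) a r' ha4 (by omega) (by omega) (by omega) hm'
    exact below_within_case D hK a r har hk2 hm hcap' z (by omega) r' hr' hIH

/-- **THE STABILITY TABLE BELOW THE DIAGONAL FOR `r ≤ 2`:** `K₄⁻`-free, `4 ≤ a`, `r ≤ 2`, `r + 3 ≤ a`, `2a + r ≤ k`,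
`m + r = a (k − a)` ⇒ `D` is a spanning subgraph of some `K(A, Aᶜ)` with `|A| = a`, or
`Σ_v d(v)² + r (k − 1 − r) + 2 (k − 2a − 1)(a − r) ≤ m k`. -/
theorem below_second_order_gen (D : SimpleGraph V) [DecidableRel D.Adj] (hK : K4mFree D) (a r : ℕ)
    (ha4 : 4 ≤ a) (hr2 : r ≤ 2) (har : r + 3 ≤ a) (hk : 2 * a + r ≤ Fintype.card V)
    (hm : D.edgeFinset.card + r = a * (Fintype.card V - a)) :
    (∃ A : Finset V, A.card = a ∧ BipSub D A) ∨
      ∑ v, deg D v * deg D v + r * (Fintype.card V - 1 - r) + 2 * (Fintype.card V - 2 * a - 1) * (a - r) ≤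
        D.edgeFinset.card * Fintype.card V :=
  below_second_order_gen_aux (Fintype.card V) V D rfl hK a r ha4 hr2 har hk hm

/-- **ONE BELOW THE DIAGONAL AT SECOND ORDER, EVERY ROW `a ≥ 4`:** `K₄⁻`-free, `2a + 1 ≤ k`, `m + 1 = a (k − a)` ⇒
`a`-bipartite (then extremal) or `Σ_v d(v)² + (k − 2) + 2 (k − 2a − 1)(a − 1) ≤ m k`. -/
theorem one_below_second_order_gen (D : SimpleGraph V) [DecidableRel D.Adj] (hK : K4mFree D) (a : ℕ)
    (ha : 4 ≤ a) (hk : 2 * a + 1 ≤ Fintype.card V) (hm : D.edgeFinset.card + 1 = a * (Fintype.card V - a)) :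
    (∃ A : Finset V, A.card = a ∧ BipSub D A) ∨
      ∑ v, deg D v * deg D v + (Fintype.card V - 2) + 2 * (Fintype.card V - 2 * a - 1) * (a - 1) ≤
        D.edgeFinset.card * Fintype.card V := by
  rcases below_second_order_gen D hK a 1 ha (by norm_num) (by omega) hk hm with h | h
  · exact Or.inl h
  · right
    have e : Fintype.card V - 1 - 1 = Fintype.card V - 2 := by omega
    rw [e, one_mul] at h
    exact h

/-- **TWO BELOW THE DIAGONAL AT SECOND ORDER, EVERY ROW `a ≥ 5`:** `K₄⁻`-free, `2a + 2 ≤ k`, `m + 2 = a (k − a)` ⇒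
`a`-bipartite or `Σ_v d(v)² + 2 (k − 3) + 2 (k − 2a − 1)(a − 2) ≤ m k`. -/
theorem two_below_second_order_gen (D : SimpleGraph V) [DecidableRel D.Adj] (hK : K4mFree D) (a : ℕ)
    (ha : 5 ≤ a) (hk : 2 * a + 2 ≤ Fintype.card V) (hm : D.edgeFinset.card + 2 = a * (Fintype.card V - a)) :
    (∃ A : Finset V, A.card = a ∧ BipSub D A) ∨
      ∑ v, deg D v * deg D v + 2 * (Fintype.card V - 3) + 2 * (Fintype.card V - 2 * a - 1) * (a - 2) ≤
        D.edgeFinset.card * Fintype.card V := by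
  rcases below_second_order_gen D hK a 2 (by omega) (le_refl 2) (by omega) hk hm with h | h
  · exact Or.inl h
  · right
    have e : Fintype.card V - 1 - 2 = Fintype.card V - 3 := by omega
    rw [e] at h
    exact h

/-- An `a`-bipartite graph with one missing cross pair is extremal: `Σ_v d(v)² + (k − 2) = m k`. -/
theorem sum_deg_sq_eq_of_bipSub_one (D : SimpleGraph V) [DecidableRel D.Adj] (A : Finset V) (a : ℕ)
    (hA : A.card = a) (hB : BipSub D A) (hm : D.edgeFinset.card + 1 = a * (Fintype.card V - a))
    (hk : 2 ≤ Fintype.card V) :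
    ∑ v, deg D v * deg D v + (Fintype.card V - 2) = D.edgeFinset.card * Fintype.card V := by
  haveI : Nonempty V := Fintype.card_pos_iff.mp (by omega)
  obtain ⟨v, hv⟩ := exists_missingStar_of_one D A hB a hA hm
  have h := closed_form_eq_of_missingStar D A hB hv a 1 hA hm (by omega)
  have e : Fintype.card V - 1 - 1 = Fintype.card V - 2 := by omega
  rw [e, one_mul] at h
  exact h

/-- **THE SECOND-BEST VALUE ONE BELOW THE DIAGONAL, EVERY ROW `a ≥ 4`:** for `2a + 2 ≤ k`, every non-extremal
`K₄⁻`-free graph on `Fin k` with `a (k − a) − 1` edges has `Σ_v d(v)² + (k − 2) + 2 (k − 2a − 1)(a − 1) ≤ m k`, and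
the value is attained (`K_{a+1,k−a−1}` minus a `(k − 2a)`-star: the family `B2` of §10bt(c) at `r = 1`). -/
theorem one_below_second_best_gen (k a : ℕ) (ha : 4 ≤ a) (hk : 2 * a + 2 ≤ k) :
    (∀ (D : SimpleGraph (Fin k)) [DecidableRel D.Adj], K4mFree D → D.edgeFinset.card + 1 = a * (k - a) →
        ∑ v, deg D v * deg D v + (k - 2) ≠ D.edgeFinset.card * k →
        ∑ v, deg D v * deg D v + (k - 2) + 2 * (k - 2 * a - 1) * (a - 1) ≤ D.edgeFinset.card * k) ∧
      ∃ (D : SimpleGraph (Fin k)) (_ : DecidableRel D.Adj), K4mFree D ∧ D.edgeFinset.card + 1 = a * (k - a) ∧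
        ∑ v, deg D v * deg D v + (k - 2) + 2 * (k - 2 * a - 1) * (a - 1) = D.edgeFinset.card * k := by
  have hcard : Fintype.card (Fin k) = k := Fintype.card_fin k
  refine ⟨?_, ?_⟩
  · intro D _ hK hm hne
    rcases one_below_second_order_gen D hK a ha (by omega) (by rw [hcard]; exact hm) with ⟨A, hAcard, hA⟩ | h
    · exfalso
      apply hne
      have := sum_deg_sq_eq_of_bipSub_one D A a hAcard hA (by rw [hcard]; exact hm) (by omega)
      rw [hcard] at this
      exact this
    · rw [hcard] at h
      exact h
  · obtain ⟨D, inst, hK, hE, hS⟩ := other_bipartition_value k a 1 (by omega) (by omega) hk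
    have hpos : 1 ≤ a * (k - a) := Nat.one_le_iff_ne_zero.mpr (Nat.mul_ne_zero (by omega) (by omega))
    have hE' : D.edgeFinset.card + 1 = a * (k - a) := by omega
    refine ⟨D, inst, hK, hE', ?_⟩
    have e1 : k - 1 - 1 = k - 2 := by omega
    rw [e1, one_mul] at hS
    rw [hS]
    congr 1
    omega

end C047

end TriangleCap

end PercRepro
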